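import Literature.AlgebraicGeometry.AbelianSchemes.HomFactorsThroughMulNLocus
import Literature.AlgebraicGeometry.AbelianSchemes.AbelianSchemeOverMulNFiniteFlat
import HarnessLib

/-!
# Descent of a homomorphism of abelian schemes through `[N]` for every `N ≠ 0`, over an ARBITRARY base
# ([MumfordAV1970] §7 Thm. 4; [MumfordFogartyKirwan1994] Ch. 6 §2 Lemma 6.12 and the proof of Prop. 6.11)

Layer `Literature/AlgebraicGeometry/AbelianSchemes`, namespace `Literature.AlgebraicGeometry.AbelianSchemes.AbelianSchemeOver`.
THEOREMS ONLY (no definition, no named fact, no instance, no notation, no `sorry`).  Sequel of ★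
`HomFactorsThroughMulNLocus` §2 (`existsUnique_pow_id_comp_eq_of_forall_pow_eq_one`: a homomorphism `φ : A → B` of abelian
schemes killing every `N`-torsion point factors UNIQUELY as `φ = [N] ≫ ψ` — stated there for `N` INVERTIBLE on the base, because its
engine ★ `flat_pow_id_left` ∕ ★ `surjective_pow_id_left` was the étale edition of `[N]`).  Its docstring already names the general
road: «over a general base one would use the flatness of `ψ_N` of MFK Lemma 6.12 in place of ★ `flat_pow_id_left`».  That flatness
is NOW in the tree for every `N ≠ 0` over ANY base (★ `AbelianSchemeOverMulNFiniteFlat`: `flat_pow_id_left_of_ne_zero`,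
`surjective_pow_id_left_of_ne_zero`, by the fibrewise criterion), so the same proof runs verbatim WITHOUT invertibility — the edition
consumed in residue characteristic `p` with `N = p^m` (Serre–Tate: [Katz1981SerreTate] Lemma 1.1.3 (4) «`f₀` lifts iff `N^ν f` kills
`G[N^ν]`», division by `[N^ν]` on the abelian scheme).

* `existsUnique_pow_id_comp_eq_of_forall_pow_eq_one_of_ne_zero` — `∃! ψ, [N] ≫ ψ = φ` (`A` commutative, `N ≠ 0`, any `S`):
  `[N].left` is flat, surjective and quasi-compact (proper), hence an effective epimorphism of schemes (Mathlib, fpqc descent of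
  morphisms), and `φ.left` coequalises its kernel pair (★ `comp_eq_comp_of_comp_pow_id_eq`, MFK's «`p₂ − p₁`»);
* `isMonHom_of_pow_id_comp_eq_of_ne_zero` — the factorisation `ψ` is a homomorphism (★ `isMonHom_of_comp_of_flat_surjective`);
* `exists_isMonHom_pow_id_comp_eq_of_forall_pow_eq_one_of_ne_zero` — the packaged form `∃ ψ, IsMonHom ψ ∧ [N] ≫ ψ = φ ∧ unique`.

The bodies are those of ★ `HomFactorsThroughMulNLocus` §2 (B-p17 (g12)) with the two instance lines replaced; credited here.
Cell hodgecm-mathlib (D-0151 ∕ D-0183 FLOOR 0), P6 «MOD programme» Row 4B (Serre–Tate), organ (O2) of F0P6-p12 (g0)'s census for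
`stub_L4B1ff_serreTateHomLift` (`Cruxes/HLiu418/Lines/F0_P6b_BTSerreTate.lean`); generic, count-neutral capital on
`--supports stmt-HodgeConjecture-24832`.  HC_CM is proved only modulo the printed citations until rung 0 closes; nothing here is about HC.

## References
* [MumfordAV1970] D. Mumford, *Abelian Varieties* (1970), §7 Thm. 4 (p. 72) (a homomorphism killing the kernel of an isogeny
  factors uniquely through it, by a homomorphism).
* [MumfordFogartyKirwan1994] D. Mumford, J. Fogarty, F. Kirwan, *Geometric Invariant Theory*, 3rd ed. (1994), Ch. 6 §2 Lemma 6.12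
  (p. 122: `ψ_N` is flat and surjective) and the proof of Prop. 6.11 (pp. 122–123: descent through `ψ_{2k}`).
* [Katz1981SerreTate] N. Katz, *Serre–Tate local moduli*, LNM 868 (1981), §1.1 Lemma 1.1.3 (4) (the consumer).
* [SGA1] A. Grothendieck, M. Raynaud, *SGA 1* (LNM 224), Exp. VIII Thm. 5.2 (fpqc descent of morphisms).
-/

set_option backward.isDefEq.respectTransparency false

noncomputable section

open CategoryTheory CategoryTheory.Limits AlgebraicGeometry MonoidalCategory CartesianMonoidalCategory
open scoped MonObj

universe u

namespace Literature.AlgebraicGeometry.AbelianSchemes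

namespace AbelianSchemeOver

variable {S : Scheme.{u}} (A : AbelianSchemeOver S) {B : AbelianSchemeOver S}
  [IsCommMonObj A.X] (φ : A.X ⟶ B.X) [IsMonHom φ] {N : ℕ}

/-- **DESCENT THROUGH `[N]`, `N ≠ 0`, ANY BASE** ([MumfordAV1970] §7 Thm. 4 for the isogeny `[N]`; [MumfordFogartyKirwan1994]
Lemma 6.12 + proof of Prop. 6.11): for `A` commutative and `N ≠ 0`, a homomorphism `φ : A → B` of abelian schemes over `S` which
kills every `N`-torsion point (`t ^ N = 1 → t ≫ φ = 1` for all `T`-valued points `t`, `T` any `S`-scheme) factors UNIQUELY through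
`[N] = (𝟙_A)^N`: `∃! ψ, [N] ≫ ψ = φ`.  `[N].left` is flat and surjective for every `N ≠ 0` over any base (★
`flat_pow_id_left_of_ne_zero`, ★ `surjective_pow_id_left_of_ne_zero`) and proper, hence an effective epimorphism of schemes, and
`φ.left` coequalises its kernel pair (★ `comp_eq_comp_of_comp_pow_id_eq`).  Body adapted verbatim from ★
`existsUnique_pow_id_comp_eq_of_forall_pow_eq_one` (the `N`-invertible edition).
[cite: MumfordAV1970, §7 Thm. 4 (p. 72)] [cite: MumfordFogartyKirwan1994, Ch. 6 §2 Lemma 6.12 and Prop. 6.11 (p. 122; proof pp. 122–123)]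
[cite: SGA1, Exp. VIII Thm. 5.2] -/
theorem existsUnique_pow_id_comp_eq_of_forall_pow_eq_one_of_ne_zero (hN : N ≠ 0)
    (hφ : ∀ ⦃T : Over S⦄ (t : T ⟶ A.X), t ^ N = 1 → t ≫ φ = 1) :
    ∃! ψ : A.X ⟶ B.X, ((𝟙 A.X : A.X ⟶ A.X) ^ N) ≫ ψ = φ := by
  -- `q = [N].left` is an effective epimorphism of schemes
  haveI := A.flat_pow_id_left_of_ne_zero hN
  haveI := A.surjective_pow_id_left_of_ne_zero hN
  haveI : QuasiCompact ((((𝟙 A.X : A.X ⟶ A.X) ^ N) : A.X ⟶ A.X).left) := by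
    haveI := A.isProper_pow_id_left N
    infer_instance
  have hco : ∀ {Z : Scheme.{u}} (a b : Z ⟶ A.X.left),
      a ≫ (((𝟙 A.X : A.X ⟶ A.X) ^ N) : A.X ⟶ A.X).left = b ≫ (((𝟙 A.X : A.X ⟶ A.X) ^ N) : A.X ⟶ A.X).left →
        a ≫ φ.left = b ≫ φ.left :=
    fun a b hab => A.comp_eq_comp_of_comp_pow_id_eq φ hφ a b hab
  let ψ₀ : A.X.left ⟶ B.X.left := EffectiveEpi.desc ((((𝟙 A.X : A.X ⟶ A.X) ^ N) : A.X ⟶ A.X).left) φ.left hco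
  have hψ₀ : (((𝟙 A.X : A.X ⟶ A.X) ^ N) : A.X ⟶ A.X).left ≫ ψ₀ = φ.left := EffectiveEpi.fac _ _ _
  have hw : ψ₀ ≫ B.X.hom = A.X.hom := by
    rw [← cancel_epi ((((𝟙 A.X : A.X ⟶ A.X) ^ N) : A.X ⟶ A.X).left), ← Category.assoc, hψ₀, Over.w, Over.w]
  refine ⟨Over.homMk ψ₀ hw, Over.OverMorphism.ext hψ₀, fun ψ' hψ' => Over.OverMorphism.ext ?_⟩
  have hψ'' : ((𝟙 A.X : A.X ⟶ A.X) ^ N) ≫ ψ' = φ := hψ'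
  change ψ'.left = ψ₀
  rw [← cancel_epi ((((𝟙 A.X : A.X ⟶ A.X) ^ N) : A.X ⟶ A.X).left), hψ₀, ← Over.comp_left, hψ'']

/-- **The factorisation `ψ` of `φ = [N] ≫ ψ` is a homomorphism**, `N ≠ 0`, any base (`[N]` is a flat surjective homomorphism for
`A` commutative; ★ `isMonHom_of_comp_of_flat_surjective` — [MumfordAV1970] §7 Thm. 4).  Body adapted from ★
`isMonHom_of_pow_id_comp_eq`. [cite: MumfordAV1970, §7 Thm. 4 (p. 72)] [cite: MumfordFogartyKirwan1994, Ch. 6 §2 Lemma 6.12 (p. 122)] -/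
theorem isMonHom_of_pow_id_comp_eq_of_ne_zero (hN : N ≠ 0) {ψ : A.X ⟶ B.X}
    (hψ : ((𝟙 A.X : A.X ⟶ A.X) ^ N) ≫ ψ = φ) : IsMonHom ψ := by
  haveI := A.flat_pow_id_left_of_ne_zero hN
  haveI := A.surjective_pow_id_left_of_ne_zero hN
  haveI : IsMonHom ((𝟙 A.X : A.X ⟶ A.X) ^ N) := A.isMonHom_mulN N
  exact isMonHom_of_comp_of_flat_surjective ((𝟙 A.X : A.X ⟶ A.X) ^ N) ψ (by rw [hψ]; infer_instance)

/-- Descent through `[N]` (`N ≠ 0`, any base) with the homomorphism clause packaged: `∃ ψ, IsMonHom ψ ∧ [N] ≫ ψ = φ`, and any two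
factorisations agree — the form [Katz1981SerreTate] Lemma 1.1.3 (4) consumes with `N = p^ν` in residue characteristic `p`.
[cite: MumfordAV1970, §7 Thm. 4 (p. 72)] [cite: MumfordFogartyKirwan1994, Ch. 6 §2 Prop. 6.11 (p. 122; proof pp. 122–123)] -/
theorem exists_isMonHom_pow_id_comp_eq_of_forall_pow_eq_one_of_ne_zero (hN : N ≠ 0)
    (hφ : ∀ ⦃T : Over S⦄ (t : T ⟶ A.X), t ^ N = 1 → t ≫ φ = 1) :
    ∃ ψ : A.X ⟶ B.X, IsMonHom ψ ∧ ((𝟙 A.X : A.X ⟶ A.X) ^ N) ≫ ψ = φ ∧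
      ∀ ψ' : A.X ⟶ B.X, ((𝟙 A.X : A.X ⟶ A.X) ^ N) ≫ ψ' = φ → ψ' = ψ := by
  obtain ⟨ψ, hψ, huniq⟩ := A.existsUnique_pow_id_comp_eq_of_forall_pow_eq_one_of_ne_zero φ hN hφ
  exact ⟨ψ, A.isMonHom_of_pow_id_comp_eq_of_ne_zero φ hN hψ, hψ, huniq⟩

end AbelianSchemeOver

end Literature.AlgebraicGeometry.AbelianSchemes

end
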